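import Literature.Geometry.Lorentzian.ChartMetricCoord
import Literature.Geometry.Lorentzian.CoordMomentumConstraintVariation
import Literature.Geometry.Lorentzian.LeviCivitaCovDerivProofs
import Literature.Geometry.Lorentzian.InitialDataLocality
import Literature.Geometry.Lorentzian.InitialDataDilation
import Literature.Geometry.Lorentzian.InteriorKerrGluing
import HarnessLib

/-!
# The constraint map of an initial data set is the coordinate constraint map of its components

Link file (everything PROVED; no definition, no statement of `Prop` type) between the abstract
constraint functions of an initial data set (`InitialDataSet.hamiltonianConstraintFn`,
`momentumConstraintFn` of `InitialData.lean`: scalar curvature, `|k|²`, `tr k`, `div k`, `d tr k`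
of the Levi-Civita calculus of `LeviCivita.lean`) and the coordinate constraint map of a pair of
coefficient fields (`MetricCoord.hamAt G K = S_G − |K|²_G + (tr_G K)²` of
`CoordScalarCurvatureFirstVariation.lean`, `MetricCoord.momFn b G K = div_G K − d tr_G K` of
`CoordMomentumConstraintVariation.lean`), i.e. the statement that the linearisation / adjoint /
Green-identity calculus of `CoordScalarCurvatureAdjoint.lean`, `CoordMomentumConstraintAdjoint.lean`,
`CoordConstraintAdjoint.lean` (the `DΦ`, `DΦ*` of the Corvino–Schoen / Chruściel–Delay gluing
scheme, Li–Mei 2020, §4) IS the calculus of the constraint map `Φ = (H, M)` of the tree's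
`InitialDataSet`:

* `OpensChart.covDeriv₂_eq_cov₂At` — on a chart domain `U : Opens E`, the covariant differential
  `(∇k)_x(X₀, Y₀; Z₀)` of a field of bilinear forms (`PseudoRiemannianMetric.covDeriv₂`,
  derivative slot last) is the coordinate one `cov₂At G K x Z₀ X₀ Y₀` of its representative
  (O'Neill 1983, Ch. 2, Prop. 2.13 / Ch. 3, Def. 3.16–3.17, on constant fields);
* `OpensChart.divergence_apply_eq_sum` — `(div_h k)_x(Y₀) = Σ_{ij} g^{ij} (∇_{b_i} K)(b_j, Y₀)`
  (O'Neill 1983, Ch. 3, p. 86);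
* `OpensChart.traceK_eq_mtrAt`, `normSqK_eq_normSqAt`, `hamiltonianConstraintFn_eq_hamAt`,
  `mfderiv_traceK_eq`, `momentumConstraintFn_eq_momFn` — for data on a chart domain;
* `InitialDataSet.isMetricOn_coordH`, `hamiltonianConstraintFn_eq_hamAt_coord`,
  `momentumConstraintFn_eq_momFn_coord` — for data on `E3 = ℝ³` itself, read through
  `InitialDataSet.coordH / coordK` (restriction to the open submanifold `⊤` along the inclusion,
  whose differential is the identity, and naturality of the constraint map,
  `hamiltonianConstraintFn_comap`, `momentumConstraintFn_comap_apply`; Bartnik–Isenberg 2004, §2);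
* `LiMei.isVacuumOn_iff_coord` — the localised vacuum predicate of `InteriorKerrGluing.lean` in
  coordinates: `IsVacuumOn s D ↔ ∀ y ∈ s, hamAt (coordH D) (coordK D) y = 0 ∧ momFn b … y = 0`.

This is the adapter through which the coordinate deformation calculus acts on the data of the
named fact `LiMei.interiorKerrGluing` (Li–Mei, arXiv:2005.01249, Prop. 4.1: the constraint map
`Φ(g, π)` of §4 evaluated on data on the annulus of `E3`).

## References

* B. O'Neill, *Semi-Riemannian geometry with applications to relativity*, 1983, Ch. 2,
  Prop. 2.13; Ch. 3, Def. 3.16–3.17, p. 86, Prop. 3.59. [ONeill1983]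
* R. Bartnik, J. Isenberg, *The constraint equations*, 2004, §2, (2.1)–(2.2). [BartnikIsenberg2004]
* J. Li, H. Mei, *A construction of collapsing spacetimes in vacuum*, Comm. Math. Phys. 378
  (2020), arXiv:2005.01249, §4. [LiMei2020]
-/

noncomputable section

set_option maxSynthPendingDepth 3

open Bundle Set Function Filter TopologicalSpace Manifold Module
open scoped Manifold ContDiff Topology

namespace Literature.Geometry.Lorentzian

/-! ### Chart domains: the covariant differential and the divergence of a field of bilinear forms -/

namespace OpensChart

variable {E : Type*} [NormedAddCommGroup E] [NormedSpace ℝ E] [FiniteDimensional ℝ E]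
  [CompleteSpace E] {U : Opens E}

section CovDiv

variable {g : PseudoRiemannianMetric 𝓘(ℝ, E) ∞ E (TangentSpace 𝓘(ℝ, E) : U → Type _)}
  {G : E → E →L[ℝ] E →L[ℝ] ℝ} (hG : ∀ y : U, g.val y = G y)

include hG

/-- **The covariant differential of a field of bilinear forms is `cov₂At` of its representative**:
on a chart domain `U`, for a field `k` of bilinear forms with `C¹` representative `K`
(`k y = K y` on `U`), `(∇k)_x(X₀, Y₀; Z₀) = (∇_{Z₀} K)(X₀, Y₀) = ∂_{Z₀}K(X₀,Y₀) − K(Γ(Z₀,X₀),Y₀) −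
K(X₀, Γ(Z₀,Y₀))` (`PseudoRiemannianMetric.covDeriv₂` has the derivative slot last,
`MetricCoord.cov₂At` first). O'Neill 1983, Ch. 2, Prop. 2.13 and Ch. 3, Def. 3.16–3.17, evaluated
on constant fields (`covDeriv₂_apply`, `leviCivita_const_const_apply`).
[cite: ONeill1983, Ch. 3, Def. 3.16–3.17] -/
theorem covDeriv₂_eq_cov₂At [g.HasLeviCivita] (x : U)
    {k : Π y : U, TangentSpace 𝓘(ℝ, E) y →L[ℝ] TangentSpace 𝓘(ℝ, E) y →L[ℝ] ℝ}
    {K : E → E →L[ℝ] E →L[ℝ] ℝ} (hk : ∀ y : U, k y = K y) (hK : ContDiffAt ℝ 1 K x)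
    (X₀ Y₀ Z₀ : E) :
    g.covDeriv₂ k x X₀ Y₀ Z₀ = MetricCoord.cov₂At G K x Z₀ X₀ Y₀ := by
  have hsec : MDifferentiableAt 𝓘(ℝ, E) (𝓘(ℝ, E).prod 𝓘(ℝ, E →L[ℝ] E →L[ℝ] ℝ))
      (fun y : U ↦ TotalSpace.mk' (E →L[ℝ] E →L[ℝ] ℝ)
        (E := fun y : U ↦ TangentSpace 𝓘(ℝ, E) y →L[ℝ] TangentSpace 𝓘(ℝ, E) y →L[ℝ] ℝ) y (k y)) x :=
    ((contMDiffAt_bilinSection_iff x k K hk).2 hK).mdifferentiableAt one_ne_zero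
  have h := g.covDeriv₂_apply_holds (x := x) hsec (X := fun _ : U ↦ (X₀ : E))
    (Y := fun _ : U ↦ (Y₀ : E)) (Z := fun _ : U ↦ (Z₀ : E)) (mdifferentiableAt_const_section x X₀)
    (mdifferentiableAt_const_section x Y₀) (mdifferentiableAt_const_section x Z₀)
  rw [h]
  unfold PseudoRiemannianMetric.covDeriv₂Aux
  have hKd : DifferentiableAt ℝ K x := hK.differentiableAt one_ne_zero
  have hd : DifferentiableAt ℝ (fun y ↦ K y X₀ Y₀) x := differentiableAt_apply₂ K hKd X₀ Y₀
  rw [mvfderiv_eq x (fun y : U ↦ k y X₀ Y₀) (fun y ↦ K y X₀ Y₀) (fun y ↦ by rw [hk]; rfl) hd,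
    fderiv_apply₂ K hKd, leviCivita_const_const_apply hG x X₀ Z₀,
    leviCivita_const_const_apply hG x Y₀ Z₀, christoffel_eq_chrAt hG x Z₀ X₀,
    christoffel_eq_chrAt hG x Z₀ Y₀, MetricCoord.cov₂At_apply, hk]
  rfl

/-- **The divergence of a field of bilinear forms in a basis**: on a chart domain,
`(div_g k)_x(Y₀) = Σ_{ij} g^{ij}(x) (∇_{b_i} K)(b_j, Y₀)` for the representative `K` of `k`
(metric trace over the derivative slot and the first slot; the inverse coefficients are symmetric).
O'Neill 1983, Ch. 3, p. 86. [cite: ONeill1983, Ch. 3, p. 86] -/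
theorem divergence_apply_eq_sum [g.HasLeviCivita] {ι : Type*} [Fintype ι] (b : Basis ι ℝ E)
    (x : U) {k : Π y : U, TangentSpace 𝓘(ℝ, E) y →L[ℝ] TangentSpace 𝓘(ℝ, E) y →L[ℝ] ℝ}
    {K : E → E →L[ℝ] E →L[ℝ] ℝ} (hk : ∀ y : U, k y = K y) (hK : ContDiffAt ℝ 1 K x) (Y₀ : E) :
    g.divergence k x Y₀ =
      ∑ i, ∑ j, MetricCoord.ginv G b x i j * MetricCoord.cov₂At G K x (b i) (b j) Y₀ := by
  rw [PseudoRiemannianMetric.divergence_apply]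
  set T := MetricCoord.cov₂At G K x with hT
  set β : E →L[ℝ] E →L[ℝ] ℝ := (MetricCoord.flipCLM.comp T.flip).flip Y₀ with hβ
  have hβ' : ∀ v w, β v w = T w v Y₀ := fun v w ↦ by
    simp only [hβ, ContinuousLinearMap.flip_apply, ContinuousLinearMap.comp_apply,
      MetricCoord.flipCLM_apply]
  rw [trace_eq_mtrAt hG x (g.divergenceAux k x Y₀) β (fun v w ↦ by
      change g.covDeriv₂ k x v Y₀ w = β v w
      rw [covDeriv₂_eq_cov₂At hG x hk hK, hβ']),
    MetricCoord.mtrAt_eq_sum b, Finset.sum_comm]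
  refine Finset.sum_congr rfl fun i _ ↦ Finset.sum_congr rfl fun j _ ↦ ?_
  rw [hβ', MetricCoord.ginv_comm b (isInvertible_repr hG x) ((isMetricOn_repr hG).symm x x.2)]

end CovDiv

/-! ### Chart domains: the constraint functions of a datum are `hamAt` / `momFn` of its components -/

section Data

variable {D : InitialDataSet 𝓘(ℝ, E) U} {G K : E → E →L[ℝ] E →L[ℝ] ℝ}
  (hG : ∀ y : U, D.metric.val y = G y) (hk : ∀ y : U, D.k y = K y)

include hk in
omit [FiniteDimensional ℝ E] [CompleteSpace E] in
/-- The representative of the tensor `k` of a datum on a chart domain is smooth at the points of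
the domain. [folklore] -/
theorem contDiffAt_reprK (y : U) : ContDiffAt ℝ ∞ K y :=
  (contMDiffAt_bilinSection_iff y D.k K hk).1 (D.contMDiff_k y)

include hG hk

omit [CompleteSpace E] in
/-- **The mean curvature is the coordinate metric trace**: `tr_h k (y) = tr_G K (y)` on `U`.
Choquet-Bruhat 2009, Ch. VI, (3.9); O'Neill 1983, Ch. 3, pp. 60–61. [cite: ONeill1983, Ch. 3, pp. 60–61] -/
theorem traceK_eq_mtrAt (y : U) : D.traceK y = MetricCoord.mtrAt G y (K y) :=
  trace_eq_mtrAt hG y (D.kBilin y) (K y) fun v w ↦ by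
    change D.k y v w = K y v w
    rw [hk]
    rfl

omit [CompleteSpace E] in
/-- **`|k|²_h` is the coordinate square norm**: `|k|²_h (y) = |K|²_G (y)` on `U`.
[cite: ONeill1983, Ch. 3, pp. 60–61] -/
theorem normSqK_eq_normSqAt (y : U) : D.normSqK y = MetricCoord.normSqAt G y (K y) :=
  normSq_eq_normSqAt hG y (D.kBilin y) (K y) fun v w ↦ by
    change D.k y v w = K y v w
    rw [hk]
    rfl

/-- **The Hamiltonian constraint function of a datum on a chart domain is `hamAt` of its
components**: `(R(h) − |k|² + (tr k)²)(y) = (S_G − |K|²_G + (tr_G K)²)(y)`.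
Bartnik–Isenberg 2004, (2.1). [cite: BartnikIsenberg2004, (2.1)] -/
theorem hamiltonianConstraintFn_eq_hamAt [D.metric.HasLeviCivita] (y : U) :
    D.hamiltonianConstraintFn y = MetricCoord.hamAt G K y := by
  rw [InitialDataSet.hamiltonianConstraintFn, MetricCoord.hamAt_eq, scalarCurvature_eq_scalAt hG y,
    normSqK_eq_normSqAt hG hk y, traceK_eq_mtrAt hG hk y]

/-- The representative `y ↦ tr_G K (y)` of the mean curvature is smooth at the points of `U`.
[folklore] -/
theorem contDiffAt_mtrAt_repr (y : U) : ContDiffAt ℝ ∞ (fun z ↦ MetricCoord.mtrAt G z (K z)) y := by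
  have hKU : ContDiffOn ℝ ∞ K (U : Set E) := fun z hz ↦
    (contDiffAt_reprK hk ⟨z, hz⟩).contDiffWithinAt
  exact ((isMetricOn_repr hG).contDiffOn_mtrAt hKU y y.2).contDiffAt (coe_mem_nhds y)

/-- **The differential of the mean curvature is the derivative of the coordinate trace**:
`d(tr_h k)_y(v) = ∂_v (tr_G K)(y)` on `U`. [cite: BartnikIsenberg2004, (2.2)] -/
theorem mfderiv_traceK_eq (y : U) (v : E) :
    (show E →L[ℝ] ℝ from mfderiv 𝓘(ℝ, E) 𝓘(ℝ, ℝ) D.traceK y) v =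
      fderiv ℝ (fun z ↦ MetricCoord.mtrAt G z (K z)) y v := by
  rw [mfderiv_eq y D.traceK (fun z ↦ MetricCoord.mtrAt G z (K z)) (fun z ↦ traceK_eq_mtrAt hG hk z)
    ((contDiffAt_mtrAt_repr hG hk y).differentiableAt (by simp))]

/-- **The momentum constraint covector of a datum on a chart domain is `momFn` of its
components**: `(div_h k − d tr_h k)_y(v) = Σ_{ij} g^{ij}(∇_{b_i} K)(b_j, v) − ∂_v(tr_G K)(y)` in any
basis `b`. Bartnik–Isenberg 2004, (2.2); O'Neill 1983, Ch. 3, p. 86. [cite: BartnikIsenberg2004, (2.2)] -/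
theorem momentumConstraintFn_eq_momFn [D.metric.HasLeviCivita] {ι : Type*} [Fintype ι]
    (b : Basis ι ℝ E) (y : U) (v : E) :
    D.momentumConstraintFn y v = MetricCoord.momFn b G K y v := by
  rw [InitialDataSet.momentumConstraintFn_apply, MetricCoord.momFn_eq,
    divergence_apply_eq_sum hG b y hk ((contDiffAt_reprK hk y).of_le (by simp)) v]
  congr 1
  exact mfderiv_traceK_eq hG hk y v

end Data

end OpensChart

/-! ### Data on `E3`: the constraint functions through `coordH`, `coordK` -/

namespace InitialDataSet

variable (D : InitialDataSet (𝓡 3) E3)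

/-- The metric of the restriction of a datum on `E3` to the open submanifold `⊤ = E3` (along the
inclusion, a chart domain in the sense of `OpensChart`) is represented by `coordH D`. [folklore] -/
theorem comap_top_metric_val (u : (⊤ : Opens E3)) :
    (D.comap (Subtype.val : (⊤ : Opens E3) → E3) (contMDiff_subtypeVal_succ ⊤)
      (injective_mfderiv_subtypeVal ⊤)).metric.val u = D.coordH u := by
  ext v w
  change (D.comap (Subtype.val : (⊤ : Opens E3) → E3) (contMDiff_subtypeVal_succ ⊤)
    (injective_mfderiv_subtypeVal ⊤)).h.inner u v w = D.h.inner (u : E3) v w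
  rw [comap_h_inner, Literature.Geometry.Manifold.OpenSubmanifold.mfderiv_subtype_val]
  rfl

/-- The tensor `k` of the restriction of a datum on `E3` to `⊤` is represented by `coordK D`.
[folklore] -/
theorem comap_top_k (u : (⊤ : Opens E3)) :
    (D.comap (Subtype.val : (⊤ : Opens E3) → E3) (contMDiff_subtypeVal_succ ⊤)
      (injective_mfderiv_subtypeVal ⊤)).k u = D.coordK u := by
  ext v w
  change (D.comap (Subtype.val : (⊤ : Opens E3) → E3) (contMDiff_subtypeVal_succ ⊤)
    (injective_mfderiv_subtypeVal ⊤)).k u v w = D.k (u : E3) v w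
  rw [comap_k, Literature.Geometry.Manifold.OpenSubmanifold.mfderiv_subtype_val]
  rfl

/-- **The metric components of a datum on `E3` are a smooth, symmetric, nondegenerate field on all
of `E3`** (`MetricCoord.IsMetricOn (coordH D) univ`), so that the coordinate tensor calculus
(`CoordCurvature.lean` ff.) applies to them. [folklore] -/
theorem isMetricOn_coordH : MetricCoord.IsMetricOn D.coordH (univ : Set E3) := by
  have h := OpensChart.isMetricOn_repr (comap_top_metric_val D)
  rwa [Opens.coe_top] at h

/-- The components `coordK D` of a datum on `E3` are smooth. [folklore] -/
theorem contDiff_coordK : ContDiff ℝ ∞ D.coordK :=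
  D.contMDiff_coordK.contDiff

/-- The components `coordH D` of a datum on `E3` are smooth. [folklore] -/
theorem contDiff_coordH : ContDiff ℝ ∞ D.coordH :=
  D.contMDiff_coordH.contDiff

/-- **The Hamiltonian constraint function of a datum on `E3` is `hamAt` of its components**:
`(R(h) − |k|² + (tr k)²)(y) = hamAt (coordH D) (coordK D) y`
(restrict to the open submanifold `⊤` — naturality under the inclusion,
`hamiltonianConstraintFn_comap` — and read the restriction in the chart,
`OpensChart.hamiltonianConstraintFn_eq_hamAt`). Bartnik–Isenberg 2004, (2.1) and §2.
[cite: BartnikIsenberg2004, (2.1)] -/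
theorem hamiltonianConstraintFn_eq_hamAt_coord [D.metric.HasLeviCivita] (y : E3) :
    D.hamiltonianConstraintFn y = MetricCoord.hamAt D.coordH D.coordK y := by
  haveI : (D.comap (Subtype.val : (⊤ : Opens E3) → E3) (contMDiff_subtypeVal_succ ⊤)
      (injective_mfderiv_subtypeVal ⊤)).metric.HasLeviCivita := PseudoRiemannianMetric.hasLeviCivita _
  rw [← D.hamiltonianConstraintFn_comap (contMDiff_subtypeVal_succ ⊤) (injective_mfderiv_subtypeVal ⊤)
    rfl (⟨y, trivial⟩ : (⊤ : Opens E3))]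
  exact OpensChart.hamiltonianConstraintFn_eq_hamAt (comap_top_metric_val D) (comap_top_k D)
    ⟨y, trivial⟩

/-- **The momentum constraint covector of a datum on `E3` is `momFn` of its components** (in any
basis `b` of `E3`): `(div_h k − d tr_h k)_y(v) = momFn b (coordH D) (coordK D) y v`
(naturality under the inclusion of `⊤`, whose differential is the identity,
`momentumConstraintFn_comap_apply` with `mdifferentiableAt_traceK`; then
`OpensChart.momentumConstraintFn_eq_momFn`). Bartnik–Isenberg 2004, (2.2) and §2.
[cite: BartnikIsenberg2004, (2.2)] -/
theorem momentumConstraintFn_eq_momFn_coord [D.metric.HasLeviCivita] {ι : Type*} [Fintype ι]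
    (b : Basis ι ℝ E3) (y v : E3) :
    D.momentumConstraintFn y v = MetricCoord.momFn b D.coordH D.coordK y v := by
  haveI : (D.comap (Subtype.val : (⊤ : Opens E3) → E3) (contMDiff_subtypeVal_succ ⊤)
      (injective_mfderiv_subtypeVal ⊤)).metric.HasLeviCivita := PseudoRiemannianMetric.hasLeviCivita _
  have h := D.momentumConstraintFn_comap_apply (contMDiff_subtypeVal_succ ⊤)
    (injective_mfderiv_subtypeVal ⊤) rfl (⟨y, trivial⟩ : (⊤ : Opens E3))
    (D.mdifferentiableAt_traceK y) v
  rw [Literature.Geometry.Manifold.OpenSubmanifold.mfderiv_subtype_val] at h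
  rw [← OpensChart.momentumConstraintFn_eq_momFn (comap_top_metric_val D) (comap_top_k D) b ⟨y, trivial⟩ v]
  exact h.symm

/-- The vacuum constraint equations of a datum on `E3` at `y`, in coordinates:
`H(y) = 0 ∧ M(y) = 0 ↔ hamAt (coordH D) (coordK D) y = 0 ∧ ∀ v, momFn b (coordH D) (coordK D) y v = 0`.
[cite: BartnikIsenberg2004, (2.1)–(2.2)] -/
theorem isVacuumAt_iff_coord [D.metric.HasLeviCivita] {ι : Type*} [Fintype ι] (b : Basis ι ℝ E3)
    (y : E3) :
    (D.hamiltonianConstraintFn y = 0 ∧ D.momentumConstraintFn y = 0) ↔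
      (MetricCoord.hamAt D.coordH D.coordK y = 0 ∧
        ∀ v : E3, MetricCoord.momFn b D.coordH D.coordK y v = 0) := by
  rw [hamiltonianConstraintFn_eq_hamAt_coord]
  refine and_congr Iff.rfl ⟨fun h v ↦ ?_, fun h ↦ LinearMap.ext fun v ↦ ?_⟩
  · rw [← momentumConstraintFn_eq_momFn_coord D b y v, h, LinearMap.zero_apply]
  · rw [momentumConstraintFn_eq_momFn_coord D b y v, h v, LinearMap.zero_apply]

end InitialDataSet

/-! ### The localised vacuum predicate of `InteriorKerrGluing.lean` in coordinates -/

namespace LiMei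

/-- **`IsVacuumOn` in coordinates**: a datum `D` on `E3` solves the vacuum constraint equations on
`s` iff the coordinate constraint map of its components vanishes on `s`:
`hamAt (coordH D) (coordK D) y = 0` and `momFn b (coordH D) (coordK D) y = 0` for `y ∈ s` (any
basis `b`). This is the form in which the deformation calculus of `CoordConstraintAdjoint.lean`
(`DΦ`, `DΦ*`, the Green identity) applies to the data of Li–Mei's Prop. 4.1 (arXiv:2005.01249,
§4, the constraint map `Φ`). [cite: LiMei2020, §4] -/
theorem isVacuumOn_iff_coord {ι : Type*} [Fintype ι] (b : Basis ι ℝ E3) (s : Set E3)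
    (D : InitialDataSet (𝓡 3) E3) :
    IsVacuumOn s D ↔
      ∀ y ∈ s, MetricCoord.hamAt D.coordH D.coordK y = 0 ∧
        ∀ v : E3, MetricCoord.momFn b D.coordH D.coordK y v = 0 := by
  constructor
  · intro h y hy
    haveI : D.metric.HasLeviCivita := PseudoRiemannianMetric.hasLeviCivita _
    have hy' : D.hamiltonianConstraintFn y = 0 ∧ D.momentumConstraintFn y = 0 := h y hy
    exact (D.isVacuumAt_iff_coord b y).1 hy'
  · intro h inst y hy
    exact (D.isVacuumAt_iff_coord b y).2 (h y hy)

end LiMei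

end Literature.Geometry.Lorentzian

end
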